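import Summits.BirchSwinnertonDyer.BirchSwinnertonDyer.Theorems.SignedLowerHalvesSmallImageLowerHalfBothSignsRttRecipMTValuesClosed
import Literature.NumberTheory.EllipticCurves.TwistedLSeriesEulerProductProofs
import Literature.NumberTheory.EllipticCurves.CMNewformGamma0ResidualOfBadProofs
import Literature.NumberTheory.LFunctions.RayClassCharacterGrowth
import Literature.NumberTheory.GaloisRepresentations.HeckeCharacterOfGrossencharakter
import Literature.NumberTheory.GaloisRepresentations.ArtinLFunctionEulerFactorProofs
import HarnessLib

/-!
# S4″ θ-side, the `L`-IDENTITY in θ-currency: `L(g' ⊗ χ̄, s) = L_K(𝔣', ψ'_χ, s)` as Dirichlet series (`re s ≫ 0`)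

Summit `BirchSwinnertonDyer`, crux `SmallImageLowerHalfBothSigns` (stmt-23599), line `rtt_w3`, stub `stub_junctionRecipMT_ns` (S4″), the
«recip-an» half (LEAD g15 contract A-5, KEY 14:20Z 2026-08-31). Namespace `…Theorems.SmallImageRttReciprocity`. THEOREMS ONLY.

For the frame data of S4″ — `K` imaginary quadratic, `ψ` a Größencharakter mod `𝔪` of type `(1,0)` with `ψ((n)) = (d_K/n)·n`, the `Γ₀(M)`
newform `g` with `ι(a_ℓ(g)) = e⁻¹(Σ_{Nw=ℓ} ψ(w))` off `|d_K|·N𝔪`, the `p`-adic character `θ : Γ_K → GL₁(𝒪_S)` pinned to `ψ` at the places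
`w ∤ p𝔪` (`θ(Frob_w) = e⁻¹ψ(w)`) — and the complex conjugate newform `g'` (`a_n(g') = e(ι(a_n(g)))`, from `exists_period_transport`), we
prove, for EVERY Dirichlet character `χ` whose modulus is divisible by `p`:

  `∃ σ₀ ≥ 2, ∀ s, σ₀ < re s → twistedLSeries g' χ⁻¹ s = rayClassLSeries 𝔣' ψ' s`,

where `𝔣' ≠ 0` is any ideal with `𝔣' ∣ 𝔭_w ⟺ (p ∈ 𝔭_w ∨ θ ramified at w)` and `ψ'(w) = e(θ(Frob_w)₀₀) · χ⁻¹(N w)` at the places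
`w ∤ 𝔣'` (θ-CURRENCY: no `q`-expansion of `θ_ψ` at the primes of `𝔪` is needed). Method = equality of EULER PRODUCTS prime by prime:
newform side `IsNewform0.hasProd_twistedLSeries_two` (tree), ray-class side `hasProd_rayClassLSeries_rayClassPrimeValue_of_summable` +
`summable_norm_rayClassCoeff_mul_of_growth` (tree, growth `|ψ'(w)| ≤ N(w)^{n₀}` proved here from the exponent of the Hecke character of `ψ`
and the finiteness of the primes of `𝔪`), regrouped over the rational primes by `HasProd.under_regroup` (tree); the local identities are
Ribet's `1 − ι(a_ℓ)X + 𝟙_{ℓ∤M} ℓ X² = ∏_{w ∋ ℓ, θ unram.} (1 − θ(Frob_w) X^{f_w})` at every `ℓ ≠ p` (PROVED in the tree at the good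
primes, `eulerFactor_padicCharacter_of_not_dvd`; CITED at the primes of `|d_K|·N𝔪` through the minimal print conjunct
`Ribet1977_cmNewform_gamma0_badEulerFactor_padicCharacter`, hypothesis `hBad`), mapped to `ℂ` by `e` and evaluated at
`X = χ⁻¹(ℓ) ℓ^{−s}`; at `ℓ = p` both local factors are `1` (`χ⁻¹(p) = 0`; every `w ∣ p` divides `𝔣'`).

* §1 `one_sub_add_eq_prod_of_map`, `natCast_pow_cpow_eq_pow` — algebra.
* §2 `twistedLocalFactor_eq_finprod_of_ne` / `_of_eq` — the local identity at a rational place `v`, `ℓ_v ≠ p` / `ℓ_v = p`.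
* §3 `exists_growth_thetaTwist` — `∃ n₀ ≥ 1, |ψ'(w)| ≤ N(w)^{n₀}` off `𝔣'`.
* §4 ★ `twistedLSeries_conj_eq_rayClassLSeries` — the identity; ★ `recipMT_eq_gaussSum_mul_of_rayClassLSeries` — composed with the
  S4″ value theorem `exists_period_transport`: `Ω′·θ_n(g;Ω)^{e∘ι}(χ(γ)−1) = τ(χ)·Λ(1)` for ANY entire `Λ` agreeing with
  `rayClassLSeries 𝔣' ψ'_χ` on a right half-plane (identity theorem on `re s > 2`).

References: [Ribet1977Nebentypus] §3 Thm. (3.4), Cor. (3.5); [Shimura1971] Thm. 3.66; [NeukirchANT1999] Ch. VII §8 (8.1); [MazurTateTeitelbaum1986Invent] §I.8.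
-/

-- the Theorems namespace of this sub repeats the summit name by design (D-0017 nested layout)
set_option linter.dupNamespace false

noncomputable section

open scoped Classical MatrixGroups ModularForm NumberField
open Polynomial CongruenceSubgroup NumberField IsDedekindDomain Rat.HeightOneSpectrum
  Literature.NumberTheory.GaloisRepresentations Literature.NumberTheory.LFunctions Literature.NumberTheory.Automorphic
  Literature.NumberTheory.EllipticCurves Literature.NumberTheory.EllipticCurves.ModularForms

namespace Summit.BirchSwinnertonDyer.BirchSwinnertonDyer.Theorems.SmallImageRttReciprocity

/-! ### §1 Algebra -/

section Algebra

/-- Evaluating a polynomial identity `1 − aX + bX² = ∏_{w∈T} (1 − c_w X^{f_w})` through a ring map `φ` at a point `z`.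
[cite: Ribet1977Nebentypus, §3 Cor. (3.5)] -/
theorem one_sub_add_eq_prod_of_map {R A α : Type*} [CommRing R] [CommRing A] (φ : R →+* A) {T : Finset α} {a b : R} {c : α → R}
    {f : α → ℕ} (h : (1 - C a * X + C b * (X : R[X]) ^ 2) = ∏ w ∈ T, (1 - C (c w) * (X : R[X]) ^ f w)) (z : A) :
    1 - φ a * z + φ b * z ^ 2 = ∏ w ∈ T, (1 - φ (c w) * z ^ f w) := by
  have h' := congrArg (fun P : R[X] ↦ (P.map φ).eval z) h
  simpa only [Polynomial.map_sub, Polynomial.map_add, Polynomial.map_one, Polynomial.map_mul, Polynomial.map_pow, map_C, map_X,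
    Polynomial.map_prod, eval_sub, eval_add, eval_one, eval_mul, eval_pow, eval_C, eval_X, eval_prod] using h'

/-- `(ℓ^f)^{−s} = (ℓ^{−s})^f` for natural `ℓ`, `f`. [cite: NeukirchANT1999, Ch. VII §8 (8.1)] -/
theorem natCast_pow_cpow_eq_pow (ℓ f : ℕ) (s : ℂ) : ((ℓ ^ f : ℕ) : ℂ) ^ s = ((ℓ : ℂ) ^ s) ^ f := by
  induction f with
  | zero => simp
  | succ f ih => rw [pow_succ, Nat.cast_mul, Complex.natCast_mul_natCast_cpow, ih, pow_succ]

end Algebra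

/-! ### §2 The local identity at a rational place -/

section Local

variable {p : ℕ} [Fact p.Prime] {K : Type} [Field K] [NumberField K] {S : Set (PadicAlgCl p)}
  (θ : FramedGaloisRep K (padicCoeffIntegers S) 1) (e : PadicAlgCl p ≃+* ℂ) (φ : HeightOneSpectrum (𝓞 K) → Field.absoluteGaloisGroup K)
  (𝔣' : Ideal (𝓞 K)) {m : ℕ} (χ : DirichletCharacter ℂ m) (ψ' : HeightOneSpectrum (𝓞 K) → ℂ)

/-- **The local identity at the place `v = (p)`**: both inverse local factors are `1` — `χ⁻¹(p) = 0` as `p ∣ m`, and every `w ∣ p` divides `𝔣'`.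
[cite: MazurTateTeitelbaum1986Invent, §I.8] -/
theorem twistedLocalFactor_eq_finprod_of_eq (h𝔣' : ∀ w : HeightOneSpectrum (𝓞 K), ((p : ℕ) : 𝓞 K) ∈ w.asIdeal → 𝔣' ≤ w.asIdeal)
    (hm : p ∣ m) {M : ℕ} (a : ℕ → ℂ) (v : HeightOneSpectrum (𝓞 ℚ)) (hv : (primesEquiv v : ℕ) = p) (s : ℂ) :
    1 - χ⁻¹ (((primesEquiv v : ℕ) : ℕ) : ZMod m) * a (primesEquiv v : ℕ) * ((primesEquiv v : ℕ) : ℂ) ^ (-s) +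
        (if (primesEquiv v : ℕ) ∣ M then 0 else ((primesEquiv v : ℕ) : ℂ)) * χ⁻¹ (((primesEquiv v : ℕ) : ℕ) : ZMod m) ^ 2 *
          (((primesEquiv v : ℕ) : ℂ) ^ (-s)) ^ 2 =
      ∏ᶠ w ∈ {w : HeightOneSpectrum (𝓞 K) | w.under (𝓞 ℚ) = v},
        (1 - rayClassPrimeValue 𝔣' ψ' w * ((Ideal.absNorm w.asIdeal : ℕ) : ℂ) ^ (-s)) := by
  have hχp : χ⁻¹ (((primesEquiv v : ℕ) : ℕ) : ZMod m) = 0 := by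
    rw [hv]
    refine MulChar.map_nonunit _ fun hu ↦ ?_
    have hcop := (ZMod.isUnit_iff_coprime p m).mp hu
    exact (Fact.out : p.Prime).ne_one (Nat.Coprime.eq_one_of_dvd hcop hm)
  rw [hχp, finprod_mem_of_eqOn_one]
  · ring
  · intro w hw
    have hle : 𝔣' ≤ w.asIdeal := h𝔣' w (by rw [← hv]; exact (under_eq_iff_natCast_primesEquiv_mem w v).mp hw)
    simp only [rayClassPrimeValue, if_pos hle, zero_mul, sub_zero, Pi.one_apply]

/-- **The local identity at a place `v` with `ℓ_v ≠ p`** (Ribet's Euler factor of the CM newform at `ℓ` through the `p`-adic character, mapped to `ℂ`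
by `e` and evaluated at `X = χ⁻¹(ℓ) ℓ^{−s}`): the inverse Euler factor of `L(g' ⊗ χ⁻¹, s)` at `ℓ` (`a_ℓ(g') = e(a)`) is the product over the
places `w ∣ ℓ` of `K` of the inverse ray-class factors `1 − ψ'(w) N(w)^{−s}` (`= 1` at the `θ`-ramified `w`, which divide `𝔣'`). The
polynomial identity is the hypothesis `hpoly` (shape of `Ribet1977_cmNewform_gamma0_eulerFactor_padicCharacter` at `ℓ`, for every admissible
Frobenius set / residue degrees). [cite: Ribet1977Nebentypus, §3 Cor. (3.5)] [cite: NeukirchANT1999, Ch. I (8.2)] -/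
theorem twistedLocalFactor_eq_finprod_of_ne
    (h𝔣' : ∀ w : HeightOneSpectrum (𝓞 K), 𝔣' ≤ w.asIdeal ↔ (((p : ℕ) : 𝓞 K) ∈ w.asIdeal ∨ ¬ θ.IsUnramifiedAt w))
    (hψ' : ∀ w : HeightOneSpectrum (𝓞 K), ¬ 𝔣' ≤ w.asIdeal → ψ' w =
      e ((((θ (φ w) : GL (Fin 1) (padicCoeffIntegers S)) : Matrix (Fin 1) (Fin 1) (padicCoeffIntegers S)) 0 0 : padicCoeffIntegers S) : PadicAlgCl p) *
        χ⁻¹ ((Ideal.absNorm w.asIdeal : ℕ) : ZMod m))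
    {M : ℕ} {a : PadicAlgCl p} (a' : ℂ) (ha : a' = e a) (v : HeightOneSpectrum (𝓞 ℚ)) (hv : (primesEquiv v : ℕ) ≠ p)
    (hpoly : ∀ (Tℓ : Finset (HeightOneSpectrum (𝓞 K))) (f : HeightOneSpectrum (𝓞 K) → ℕ),
      (∀ w, w ∈ Tℓ ↔ ((((primesEquiv v : ℕ) : ℕ) : 𝓞 K) ∈ w.asIdeal ∧ θ.IsUnramifiedAt w)) →
      (∀ w ∈ Tℓ, w.residueCard = (primesEquiv v : ℕ) ^ f w) →
      (1 - C a * X + (if (primesEquiv v : ℕ) ∣ M then 0 else C (((primesEquiv v : ℕ) : ℕ) : PadicAlgCl p)) * (X : (PadicAlgCl p)[X]) ^ 2) =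
        ∏ w ∈ Tℓ, (1 - C ((((θ (φ w) : GL (Fin 1) (padicCoeffIntegers S)) : Matrix (Fin 1) (Fin 1) (padicCoeffIntegers S)) 0 0 :
          padicCoeffIntegers S) : PadicAlgCl p) * (X : (PadicAlgCl p)[X]) ^ f w))
    (s : ℂ) :
    1 - χ⁻¹ (((primesEquiv v : ℕ) : ℕ) : ZMod m) * a' * ((primesEquiv v : ℕ) : ℂ) ^ (-s) +
        (if (primesEquiv v : ℕ) ∣ M then 0 else ((primesEquiv v : ℕ) : ℂ)) * χ⁻¹ (((primesEquiv v : ℕ) : ℕ) : ZMod m) ^ 2 *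
          (((primesEquiv v : ℕ) : ℂ) ^ (-s)) ^ 2 =
      ∏ᶠ w ∈ {w : HeightOneSpectrum (𝓞 K) | w.under (𝓞 ℚ) = v},
        (1 - rayClassPrimeValue 𝔣' ψ' w * ((Ideal.absNorm w.asIdeal : ℕ) : ℂ) ^ (-s)) := by
  subst ha
  have hℓ : ((primesEquiv v : ℕ)).Prime := (primesEquiv v).2
  have hfin := setOf_under_eq_finite (K := ℚ) (L := K) v
  have hover : ∀ w : HeightOneSpectrum (𝓞 K), (((primesEquiv v : ℕ) : ℕ) : 𝓞 K) ∈ w.asIdeal ↔ w.under (𝓞 ℚ) = v :=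
    fun w ↦ (under_eq_iff_natCast_primesEquiv_mem w v).symm
  -- the Frobenius set `T = {w ∣ ℓ : θ unramified}` and the residue degrees `f(w ∣ ℓ)`
  obtain ⟨Tℓ, hTdef⟩ : ∃ T : Finset (HeightOneSpectrum (𝓞 K)), T = hfin.toFinset.filter (fun w ↦ θ.IsUnramifiedAt w) := ⟨_, rfl⟩
  have hT : ∀ w, w ∈ Tℓ ↔ ((((primesEquiv v : ℕ) : ℕ) : 𝓞 K) ∈ w.asIdeal ∧ θ.IsUnramifiedAt w) := fun w ↦ by
    rw [hTdef, Finset.mem_filter, Set.Finite.mem_toFinset, Set.mem_setOf_eq, hover]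
  have hf : ∀ w ∈ Tℓ, w.residueCard = (primesEquiv v : ℕ) ^ (w.asIdeal.inertiaDeg (𝓞 ℚ)) := fun w hw ↦ by
    have hw : w.under (𝓞 ℚ) = v := (hover w).mp ((hT w).mp hw).1
    have h := absNorm_asIdeal_eq_natGenerator_pow w
    rw [hw] at h
    exact h
  have hid := hpoly Tℓ (fun w ↦ w.asIdeal.inertiaDeg (𝓞 ℚ)) hT hf
  rw [show (if (primesEquiv v : ℕ) ∣ M then (0 : (PadicAlgCl p)[X]) else C (((primesEquiv v : ℕ) : ℕ) : PadicAlgCl p)) =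
      C (if (primesEquiv v : ℕ) ∣ M then (0 : PadicAlgCl p) else (((primesEquiv v : ℕ) : ℕ) : PadicAlgCl p)) by
    split_ifs <;> simp] at hid
  have hev := one_sub_add_eq_prod_of_map (e : PadicAlgCl p →+* ℂ) hid
    (χ⁻¹ (((primesEquiv v : ℕ) : ℕ) : ZMod m) * ((primesEquiv v : ℕ) : ℂ) ^ (-s))
  have hb : (e : PadicAlgCl p →+* ℂ) (if (primesEquiv v : ℕ) ∣ M then (0 : PadicAlgCl p) else (((primesEquiv v : ℕ) : ℕ) : PadicAlgCl p)) =
      (if (primesEquiv v : ℕ) ∣ M then 0 else ((primesEquiv v : ℕ) : ℂ)) := by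
    split_ifs <;> simp
  rw [hb] at hev
  -- each factor over `T` is the ray-class factor
  have hfac : ∀ w ∈ Tℓ,
      1 - (e : PadicAlgCl p →+* ℂ) ((((θ (φ w) : GL (Fin 1) (padicCoeffIntegers S)) : Matrix (Fin 1) (Fin 1) (padicCoeffIntegers S)) 0 0 :
          padicCoeffIntegers S) : PadicAlgCl p) *
        (χ⁻¹ (((primesEquiv v : ℕ) : ℕ) : ZMod m) * ((primesEquiv v : ℕ) : ℂ) ^ (-s)) ^ (w.asIdeal.inertiaDeg (𝓞 ℚ)) =
      1 - rayClassPrimeValue 𝔣' ψ' w * ((Ideal.absNorm w.asIdeal : ℕ) : ℂ) ^ (-s) := fun w hw ↦ by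
    obtain ⟨hℓw, hunr⟩ := (hT w).mp hw
    have hpw : ((p : ℕ) : 𝓞 K) ∉ w.asIdeal := natCast_not_mem_asIdeal_of_natCast_mem hℓ Fact.out hv hℓw
    have hnle : ¬ 𝔣' ≤ w.asIdeal := fun hle ↦ ((h𝔣' w).mp hle).elim hpw (fun h ↦ h hunr)
    have hN : Ideal.absNorm w.asIdeal = (primesEquiv v : ℕ) ^ (w.asIdeal.inertiaDeg (𝓞 ℚ)) := hf w hw
    simp only [rayClassPrimeValue, if_neg hnle, hψ' w hnle]
    rw [hN, natCast_pow_cpow_eq_pow, Nat.cast_pow, map_pow, RingHom.coe_coe]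
    ring
  -- the places over `v` outside `T` contribute `1`
  rw [finprod_mem_eq_finite_toFinset_prod _ hfin, ← Finset.prod_filter_of_ne (p := fun w ↦ θ.IsUnramifiedAt w), ← hTdef,
    ← Finset.prod_congr rfl hfac, ← hev, RingHom.coe_coe]
  · ring
  · intro w _ hne
    by_contra hram
    exact hne (by simp only [rayClassPrimeValue, if_pos ((h𝔣' w).mpr (Or.inr hram)), zero_mul, sub_zero])

end Local

/-! ### §3 The growth of `ψ'` -/

section Growth

variable {p : ℕ} [Fact p.Prime] {K : Type} [Field K] [NumberField K] {S : Set (PadicAlgCl p)}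
  (θ : FramedGaloisRep K (padicCoeffIntegers S) 1) (e : PadicAlgCl p ≃+* ℂ) (φ : HeightOneSpectrum (𝓞 K) → Field.absoluteGaloisGroup K)
  (𝔣' : Ideal (𝓞 K)) {m : ℕ} (χ : DirichletCharacter ℂ m) (ψ' : HeightOneSpectrum (𝓞 K) → ℂ)

/-- **Polynomial growth of `ψ'`**: `∃ n₀ ≥ 1, |ψ'(w)| ≤ N(w)^{n₀}` at every `w ∤ 𝔣'`. Off `𝔪` the pin gives `e(θ(Frob_w)) = ψ(w)`, of absolute
value `N(w)^{−σ}` for the exponent `σ` of the Hecke character of `ψ` (`HeckeCharacter.exists_of_isGrossencharakter`,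
`exists_norm_apply_eq_ideleNorm_rpow`, `norm_valueAtUniformizer_of_norm_eq_rpow`); the finitely many primes of `𝔪` are absorbed into `n₀`;
`|χ⁻¹| ≤ 1`. [cite: NeukirchANT1999, Ch. VII §8 (8.1)] [cite: Weil1956, §1] -/
theorem exists_growth_thetaTwist {𝔪 : Ideal (𝓞 K)} (h𝔪 : 𝔪 ≠ ⊥) {pτ qτ : InfinitePlace K → ℤ} {ψ : HeightOneSpectrum (𝓞 K) → ℂ}
    (hψ : IsGrossencharakter 𝔪 pτ qτ ψ)
    (h𝔣' : ∀ w : HeightOneSpectrum (𝓞 K), 𝔣' ≤ w.asIdeal ↔ (((p : ℕ) : 𝓞 K) ∈ w.asIdeal ∨ ¬ θ.IsUnramifiedAt w))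
    (hpin : ∀ w : HeightOneSpectrum (𝓞 K), ((p : ℕ) : 𝓞 K) ∉ w.asIdeal → ¬ 𝔪 ≤ w.asIdeal →
      e ((((θ (φ w) : GL (Fin 1) (padicCoeffIntegers S)) : Matrix (Fin 1) (Fin 1) (padicCoeffIntegers S)) 0 0 : padicCoeffIntegers S) : PadicAlgCl p) = ψ w)
    (hψ' : ∀ w : HeightOneSpectrum (𝓞 K), ¬ 𝔣' ≤ w.asIdeal → ψ' w =
      e ((((θ (φ w) : GL (Fin 1) (padicCoeffIntegers S)) : Matrix (Fin 1) (Fin 1) (padicCoeffIntegers S)) 0 0 : padicCoeffIntegers S) : PadicAlgCl p) *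
        χ⁻¹ ((Ideal.absNorm w.asIdeal : ℕ) : ZMod m)) :
    ∃ n₀ : ℕ, 1 ≤ n₀ ∧ ∀ w : HeightOneSpectrum (𝓞 K), ¬ 𝔣' ≤ w.asIdeal → ‖ψ' w‖ ≤ ‖((Ideal.absNorm w.asIdeal : ℕ) : ℂ) ^ ((n₀ : ℕ) : ℂ)‖ := by
  -- the exponent of `ψ`
  obtain ⟨ω, -, hω⟩ := HeckeCharacter.exists_of_isGrossencharakter h𝔪 hψ
  obtain ⟨σ, hσ⟩ := ω.exists_norm_apply_eq_ideleNorm_rpow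
  have hnormψ : ∀ w : HeightOneSpectrum (𝓞 K), ¬ 𝔪 ≤ w.asIdeal → ‖ψ w‖ = ((Ideal.absNorm w.asIdeal : ℕ) : ℝ) ^ (-σ) := fun w hw ↦ by
    rw [← (hω w hw).2]
    exact HeckeCharacter.norm_valueAtUniformizer_of_norm_eq_rpow hσ w
  -- the finitely many primes of `𝔪`
  have hfin : {w : HeightOneSpectrum (𝓞 K) | 𝔪 ≤ w.asIdeal}.Finite :=
    (Ideal.finite_factors h𝔪).subset fun w hw ↦ Ideal.dvd_iff_le.mpr hw
  obtain ⟨n₁, hn₁⟩ := pow_unbounded_of_one_lt (∑ w ∈ hfin.toFinset,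
    ‖e ((((θ (φ w) : GL (Fin 1) (padicCoeffIntegers S)) : Matrix (Fin 1) (Fin 1) (padicCoeffIntegers S)) 0 0 : padicCoeffIntegers S) : PadicAlgCl p)‖)
    (one_lt_two (α := ℝ))
  obtain ⟨n₂, hn₂⟩ := exists_nat_ge (-σ)
  refine ⟨max 1 (max n₁ n₂), le_max_left _ _, fun w hw ↦ ?_⟩
  have hpw : ((p : ℕ) : 𝓞 K) ∉ w.asIdeal := fun h ↦ hw ((h𝔣' w).mpr (Or.inl h))
  have hN1 : (1 : ℝ) < ((Ideal.absNorm w.asIdeal : ℕ) : ℝ) := by exact_mod_cast w.one_lt_residueCard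
  have hN2 : (2 : ℝ) ≤ ((Ideal.absNorm w.asIdeal : ℕ) : ℝ) := by exact_mod_cast w.one_lt_residueCard
  rw [hψ' w hw, norm_mul, Complex.cpow_natCast, norm_pow, Complex.norm_natCast]
  have hθle : ‖e ((((θ (φ w) : GL (Fin 1) (padicCoeffIntegers S)) : Matrix (Fin 1) (Fin 1) (padicCoeffIntegers S)) 0 0 : padicCoeffIntegers S) :
      PadicAlgCl p)‖ ≤ ((Ideal.absNorm w.asIdeal : ℕ) : ℝ) ^ (max 1 (max n₁ n₂)) := by
    by_cases h𝔪w : 𝔪 ≤ w.asIdeal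
    · have h1 := Finset.single_le_sum (s := hfin.toFinset) (f := fun w : HeightOneSpectrum (𝓞 K) ↦
        ‖e ((((θ (φ w) : GL (Fin 1) (padicCoeffIntegers S)) : Matrix (Fin 1) (Fin 1) (padicCoeffIntegers S)) 0 0 : padicCoeffIntegers S) :
          PadicAlgCl p)‖) (fun _ _ ↦ norm_nonneg _) (hfin.mem_toFinset.mpr h𝔪w)
      have h2 : (2 : ℝ) ^ n₁ ≤ ((Ideal.absNorm w.asIdeal : ℕ) : ℝ) ^ (max 1 (max n₁ n₂)) :=
        (pow_le_pow_right₀ one_le_two (le_max_of_le_right (le_max_left _ _))).trans (pow_le_pow_left₀ zero_le_two hN2 _)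
      linarith
    · rw [hpin w hpw h𝔪w, hnormψ w h𝔪w, ← Real.rpow_natCast]
      refine Real.rpow_le_rpow_of_exponent_le hN1.le (hn₂.trans ?_)
      exact_mod_cast le_max_of_le_right (le_max_right _ _)
  calc _ ≤ ((Ideal.absNorm w.asIdeal : ℕ) : ℝ) ^ (max 1 (max n₁ n₂)) * 1 :=
        mul_le_mul hθle (DirichletCharacter.norm_le_one _ _) (norm_nonneg _) (by positivity)
    _ = _ := mul_one _

end Growth

/-! ### §4 The identity -/

section Identity

variable {p : ℕ} [Fact p.Prime]

/-- ★ **`L(g' ⊗ χ⁻¹, s) = L_K(𝔣', ψ'_χ, s)` as Dirichlet series on `re s > σ₀`** (θ-currency, LEAD g15 contract A-5): for the S4″ frame data and the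
complex conjugate newform `g'` of `g` under `e∘ι`, every Dirichlet character `χ` mod `m` with `p ∣ m`, any `𝔣' ≠ 0` supported exactly on the places over `p`
and the `θ`-ramified places, and `ψ'(w) = e(θ(Frob_w)₀₀)·χ⁻¹(N w)` off `𝔣'`. Print input: ONLY the Euler factors at the primes of `|d_K|·N𝔪` (`hBad`).
[cite: Ribet1977Nebentypus, §3 Thm. (3.4), Cor. (3.5)] [cite: Shimura1971, Thm. 3.66] [cite: NeukirchANT1999, Ch. VII §8 (8.1)] -/
theorem twistedLSeries_conj_eq_rayClassLSeries (K : Type) [Field K] [NumberField K] (hK2 : Module.finrank ℚ K = 2) (htc : IsTotallyComplex K)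
    (σK : K →+* ℂ) (𝔪 : Ideal (𝓞 K)) (h𝔪 : 𝔪 ≠ ⊥) (ψ : HeightOneSpectrum (𝓞 K) → ℂ) (hψ : IsGrossencharakter 𝔪 (embType σK) (embTypeConj σK) ψ)
    (hψpow : ∀ n : ℕ, Odd n → n.Coprime ((discr K).natAbs * Ideal.absNorm 𝔪) →
      idealPow K ψ (Ideal.span {(n : 𝓞 K)}) = (jacobiSym (discr K) n : ℂ) * (n : ℂ) ^ (2 - 1))
    (e : PadicAlgCl p ≃+* ℂ) {M : ℕ} [NeZero M] (g : CuspForm (Gamma0 M) 2) (ι : coeffField g →+* PadicAlgCl p) (hng : IsNewform0 g)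
    (hcoeffψ : ∀ ℓ : ℕ, ℓ.Prime → ¬ ℓ ∣ (discr K).natAbs * Ideal.absNorm 𝔪 →
      embCoeff g ι ℓ = e.symm (∑ᶠ (w : HeightOneSpectrum (𝓞 K)) (_ : Ideal.absNorm w.asIdeal = ℓ), ψ w))
    (S : Set (PadicAlgCl p)) (θ : FramedGaloisRep K (padicCoeffIntegers S) 1)
    (hθ : ∀ w : HeightOneSpectrum (𝓞 K), ((p : ℕ) : 𝓞 K) ∉ w.asIdeal → ¬ 𝔪 ≤ w.asIdeal →
      θ.IsUnramifiedAt w ∧ ∃ P : Polynomial (padicCoeffIntegers S), P.map (padicCoeffIntegers S).subtype = X - C (e.symm (ψ w)) ∧ θ.HasFrobCharpolyAt w P)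
    (hBad : Ribet1977_cmNewform_gamma0_badEulerFactor_padicCharacter)
    (g' : CuspForm (Gamma0 M) 2) (hg' : IsNewform0 g') (hconj : ∀ n : ℕ, cuspCoeff g' n = e (ι ⟨cuspCoeff g n, coeff_mem_coeffField g n⟩))
    (φ : HeightOneSpectrum (𝓞 K) → Field.absoluteGaloisGroup K) (hφ : ∀ w : HeightOneSpectrum (𝓞 K), ∃ 𝔓 ∈ w.primesAbove, IsArithFrobAt (𝓞 K) (φ w) 𝔓)
    (𝔣' : Ideal (𝓞 K)) (h𝔣'0 : 𝔣' ≠ ⊥)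
    (h𝔣' : ∀ w : HeightOneSpectrum (𝓞 K), 𝔣' ≤ w.asIdeal ↔ (((p : ℕ) : 𝓞 K) ∈ w.asIdeal ∨ ¬ θ.IsUnramifiedAt w))
    {m : ℕ} (χ : DirichletCharacter ℂ m) (hm : p ∣ m) (ψ' : HeightOneSpectrum (𝓞 K) → ℂ)
    (hψ' : ∀ w : HeightOneSpectrum (𝓞 K), ¬ 𝔣' ≤ w.asIdeal → ψ' w =
      e ((((θ (φ w) : GL (Fin 1) (padicCoeffIntegers S)) : Matrix (Fin 1) (Fin 1) (padicCoeffIntegers S)) 0 0 : padicCoeffIntegers S) : PadicAlgCl p) *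
        χ⁻¹ ((Ideal.absNorm w.asIdeal : ℕ) : ZMod m)) :
    ∃ σ₀ : ℝ, 2 ≤ σ₀ ∧ ∀ s : ℂ, σ₀ < s.re → twistedLSeries g' χ⁻¹ s = rayClassLSeries 𝔣' ψ' s := by
  have hEF := ribet1977_cmNewform_gamma0_eulerFactor_padicCharacter_of_bad hBad
  -- the pin: `e(θ(Frob_w)) = ψ(w)` off `p𝔪`
  have hpin : ∀ w : HeightOneSpectrum (𝓞 K), ((p : ℕ) : 𝓞 K) ∉ w.asIdeal → ¬ 𝔪 ≤ w.asIdeal →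
      e ((((θ (φ w) : GL (Fin 1) (padicCoeffIntegers S)) : Matrix (Fin 1) (Fin 1) (padicCoeffIntegers S)) 0 0 : padicCoeffIntegers S) : PadicAlgCl p) =
        ψ w := fun w hpw h𝔪w ↦ by
    obtain ⟨-, P, hPmap, hP⟩ := hθ w hpw h𝔪w
    obtain ⟨𝔓, h𝔓, hF⟩ := hφ w
    rw [coe_apply_zero_zero_eq_of_hasFrobCharpolyAt θ hPmap hP h𝔓 hF, RingEquiv.apply_symm_apply]
  obtain ⟨n₀, hn₀, hgrowth⟩ := exists_growth_thetaTwist θ e φ 𝔣' χ ψ' h𝔪 hψ h𝔣' hpin hψ'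
  refine ⟨(n₀ : ℝ) + 1, by norm_cast; omega, fun s hs ↦ ?_⟩
  have hn₀' : (1 : ℝ) ≤ n₀ := by exact_mod_cast hn₀
  have hs2 : 2 < s.re := by linarith
  have hs0 : s ≠ 0 := fun h ↦ by rw [h, Complex.zero_re] at hs2; linarith
  have ht : ((n₀ : ℕ) : ℂ) ≠ 0 := by exact_mod_cast (by omega : n₀ ≠ 0)
  have hst : 1 < (s - ((n₀ : ℕ) : ℂ)).re := by
    rw [Complex.sub_re, Complex.natCast_re]
    linarith
  -- the ray-class side, regrouped over the places of `ℚ`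
  have hray := HasProd.under_regroup (K := ℚ)
    (hasProd_rayClassLSeries_rayClassPrimeValue_of_summable h𝔣'0 hs0 (summable_norm_rayClassCoeff_mul_of_growth h𝔣'0 ht hgrowth hst))
  -- the newform side over the places of `ℚ`
  have hnew : HasProd (fun v : HeightOneSpectrum (𝓞 ℚ) ↦
      (1 - χ⁻¹ (((primesEquiv v : ℕ) : ℕ) : ZMod m) * cuspCoeff g' (primesEquiv v : ℕ) * ((primesEquiv v : ℕ) : ℂ) ^ (-s) +
        (if (primesEquiv v : ℕ) ∣ M then 0 else ((primesEquiv v : ℕ) : ℂ)) * χ⁻¹ (((primesEquiv v : ℕ) : ℕ) : ZMod m) ^ 2 *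
          (((primesEquiv v : ℕ) : ℂ) ^ (-s)) ^ 2)⁻¹) (twistedLSeries g' χ⁻¹ s) :=
    ((primesEquiv (R := 𝓞 ℚ)).hasProd_iff (f := fun ℓ : Nat.Primes ↦
      (1 - χ⁻¹ ((ℓ : ℕ) : ZMod m) * cuspCoeff g' ℓ * (ℓ : ℂ) ^ (-s) +
        (if (ℓ : ℕ) ∣ M then 0 else (ℓ : ℂ)) * χ⁻¹ ((ℓ : ℕ) : ZMod m) ^ 2 * ((ℓ : ℂ) ^ (-s)) ^ 2)⁻¹)).mpr
      (hg'.hasProd_twistedLSeries_two χ⁻¹ hs2)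
  -- the local identities, place by place
  have hloc : ∀ v : HeightOneSpectrum (𝓞 ℚ),
      1 - χ⁻¹ (((primesEquiv v : ℕ) : ℕ) : ZMod m) * cuspCoeff g' (primesEquiv v : ℕ) * ((primesEquiv v : ℕ) : ℂ) ^ (-s) +
          (if (primesEquiv v : ℕ) ∣ M then 0 else ((primesEquiv v : ℕ) : ℂ)) * χ⁻¹ (((primesEquiv v : ℕ) : ℕ) : ZMod m) ^ 2 *
            (((primesEquiv v : ℕ) : ℂ) ^ (-s)) ^ 2 =
        ∏ᶠ w ∈ {w : HeightOneSpectrum (𝓞 K) | w.under (𝓞 ℚ) = v},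
          (1 - rayClassPrimeValue 𝔣' ψ' w * ((Ideal.absNorm w.asIdeal : ℕ) : ℂ) ^ (-s)) := fun v ↦ by
    by_cases hv : (primesEquiv v : ℕ) = p
    · exact twistedLocalFactor_eq_finprod_of_eq 𝔣' χ ψ' (fun w hw ↦ (h𝔣' w).mpr (Or.inl hw)) hm (fun n ↦ cuspCoeff g' n) v hv s
    · refine twistedLocalFactor_eq_finprod_of_ne θ e φ 𝔣' χ ψ' h𝔣' hψ' (cuspCoeff g' _) (hconj _) v hv (fun Tℓ f hT hf ↦ ?_) s
      exact hEF K hK2 htc σK 𝔪 h𝔪 ψ hψ hψpow p e M g ι hng hcoeffψ S θ hθ _ (primesEquiv v).2 hv Tℓ φ f hT (fun w _ ↦ hφ w) hf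
  have heq : (fun v : HeightOneSpectrum (𝓞 ℚ) ↦ ∏ᶠ w ∈ {w : HeightOneSpectrum (𝓞 K) | w.under (𝓞 ℚ) = v},
      (1 - rayClassPrimeValue 𝔣' ψ' w * ((Ideal.absNorm w.asIdeal : ℕ) : ℂ) ^ (-s))⁻¹) =
      (fun v : HeightOneSpectrum (𝓞 ℚ) ↦
        (1 - χ⁻¹ (((primesEquiv v : ℕ) : ℕ) : ZMod m) * cuspCoeff g' (primesEquiv v : ℕ) * ((primesEquiv v : ℕ) : ℂ) ^ (-s) +
          (if (primesEquiv v : ℕ) ∣ M then 0 else ((primesEquiv v : ℕ) : ℂ)) * χ⁻¹ (((primesEquiv v : ℕ) : ℕ) : ZMod m) ^ 2 *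
            (((primesEquiv v : ℕ) : ℂ) ^ (-s)) ^ 2)⁻¹) := by
    funext v
    rw [finprod_mem_inv_distrib _ (setOf_under_eq_finite v), hloc v]
  rw [heq] at hray
  exact hnew.unique hray

/-- **Analytic continuation to `re s > 2`**: an entire function agreeing with `L(g' ⊗ χ', s)` on some right half-plane `re s > σ₀ ≥ 2` agrees with it
on `re s > 2` (the twisted series converges absolutely there; identity theorem on the connected half-plane). [cite: Shimura1971, Thm. 3.66] -/
theorem eq_twistedLSeries_of_eqOn_halfPlane {M m : ℕ} [NeZero M] (g' : CuspForm (Gamma0 M) 2) (χ' : DirichletCharacter ℂ m) {Λ : ℂ → ℂ}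
    (hΛ : Differentiable ℂ Λ) {σ₀ : ℝ} (h2 : 2 ≤ σ₀) (h : ∀ s : ℂ, σ₀ < s.re → Λ s = twistedLSeries g' χ' s) (s : ℂ) (hs : 2 < s.re) :
    Λ s = twistedLSeries g' χ' s := by
  have hU : IsOpen {z : ℂ | (2 : ℝ) < z.re} := isOpen_lt continuous_const Complex.continuous_re
  have hUc : IsPreconnected {z : ℂ | (2 : ℝ) < z.re} := (convex_halfSpace_re_gt 2).isPreconnected
  have habs : LSeries.abscissaOfAbsConv (fun n ↦ χ' n * cuspCoeff g' n) ≤ (2 : ℝ) :=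
    LSeries.abscissaOfAbsConv_le_of_forall_lt_LSeriesSummable fun y hy ↦
      LSeriesSummable_dirichlet_mul_cuspCoeff_weight g' χ' (by push_cast; simp only [Complex.ofReal_re]; linarith)
  have htw : twistedLSeries g' χ' = LSeries (fun n ↦ χ' n * cuspCoeff g' n) := by
    funext z
    rfl
  have hL : AnalyticOnNhd ℂ (twistedLSeries g' χ') {z : ℂ | (2 : ℝ) < z.re} := by
    rw [htw]
    refine (LSeries_analyticOnNhd _).mono fun z hz ↦ ?_
    exact lt_of_le_of_lt habs (by exact_mod_cast hz)
  have hΛa : AnalyticOnNhd ℂ Λ {z : ℂ | (2 : ℝ) < z.re} := hΛ.differentiableOn.analyticOnNhd hU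
  have hz₀ : ((σ₀ + 1 : ℝ) : ℂ) ∈ {z : ℂ | (2 : ℝ) < z.re} := by
    simp only [Set.mem_setOf_eq, Complex.ofReal_re]
    linarith
  have hev : Λ =ᶠ[nhds ((σ₀ + 1 : ℝ) : ℂ)] twistedLSeries g' χ' := by
    have hO : IsOpen {z : ℂ | σ₀ < z.re} := isOpen_lt continuous_const Complex.continuous_re
    refine Filter.eventually_of_mem (hO.mem_nhds ?_) fun z hz ↦ h z hz
    simp only [Set.mem_setOf_eq, Complex.ofReal_re]
    linarith
  exact hΛa.eqOn_of_preconnected_of_eventuallyEq hL hUc hz₀ hev hs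

/-- ★ **The reciprocity value in ray-class currency**: from the value clause of `exists_period_transport` at `χ` (any entire `L` agreeing with
`L(g' ⊗ χ⁻¹, s)` on `re s > 2` gives `Ω′·θ_n(g;Ω)^{e∘ι}(χ(γ)−1) = τ(χ)·L(1)`) and the identity `twistedLSeries_conj_eq_rayClassLSeries`
(`L(g' ⊗ χ⁻¹, s) = R(s)` on `re s > σ₀ ≥ 2`, `R = rayClassLSeries 𝔣' ψ'_χ`): every ENTIRE `Λ` agreeing with `R` on a right half-plane computes the
value, `Ω′·T = τ(χ)·Λ(1)`. [cite: MazurTateTeitelbaum1986Invent, §I.8 (8.6)] [cite: Shimura1971, Thm. 3.66] -/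
theorem recipMT_eq_gaussSum_mul_of_rayClassLSeries {M m : ℕ} [NeZero M] {g' : CuspForm (Gamma0 M) 2} (χ : DirichletCharacter ℂ m) {Ω' T τ : ℂ}
    {R Λ : ℂ → ℂ}
    (hval : ∀ {L : ℂ → ℂ}, Differentiable ℂ L → (∀ s : ℂ, 2 < s.re → L s = twistedLSeries g' χ⁻¹ s) → Ω' * T = τ * L 1)
    (hident : ∃ σ₀ : ℝ, 2 ≤ σ₀ ∧ ∀ s : ℂ, σ₀ < s.re → twistedLSeries g' χ⁻¹ s = R s)
    (hΛ : Differentiable ℂ Λ) (hΛR : ∃ σ₁ : ℝ, ∀ s : ℂ, σ₁ < s.re → Λ s = R s) :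
    Ω' * T = τ * Λ 1 := by
  obtain ⟨σ₀, h2, hσ₀⟩ := hident
  obtain ⟨σ₁, hσ₁⟩ := hΛR
  refine hval hΛ (eq_twistedLSeries_of_eqOn_halfPlane g' χ⁻¹ hΛ (le_max_of_le_left h2 : (2 : ℝ) ≤ max σ₀ σ₁) fun s hs ↦ ?_)
  rw [hσ₁ s ((le_max_right _ _).trans_lt hs), hσ₀ s ((le_max_left _ _).trans_lt hs)]

end Identity

end Summit.BirchSwinnertonDyer.BirchSwinnertonDyer.Theorems.SmallImageRttReciprocity

end
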